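import Summits.QuantumFields.BalabanUV.Beta.GAN24.CombChargeRowsHold
import Summits.QuantumFields.BalabanUV.Beta.D1BFx.RoadEndBFxTotalMeanShell
import Summits.QuantumFields.BalabanUV.Beta.D1BFx.RoadEndBFxTotalMeanShellS
import Summits.QuantumFields.BalabanUV.Beta.D1BFx.RoadEndBFxTotalMeanSbpS

/-!
# `BalabanUV.Beta.GAN24.CombTowerEndRowD1MeanShell` — binder row G-an2-4 ∕ (CONV-C) → row D1, TRANSFER-III: **road «BF-x»'s THREE TOTAL-MEAN DEBT ENDs («(B1_mean) + table debt
# ⟹ D1Drift») AT an2's (III′) LITERAL OF RECORD `JsB12CombShSym hodd Nw (symTablesAn1S2 3 Lc cLam) cLam cBq`, THE ALL-SCALES BINDERS `hall ∕ hθ0 ∕ hθ1` SUPPLIED BY THE (III′) END OF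
# RECORD (HOLD `CombChargeRowsHold.exists_allScalesSeq_JsB12CombShSym_an1`, p609000 ✓) — NO G-an2-4 ROW LEFT** — the (III′) twin of road-P2 g54's J-54 `WrecAtEvenHalfRowsOfTowerEndMean`
# §1 ∕ §3 ∕ §4 (there: the chart-(II) literal (E) `JsRowD1Pin` over road-P2's END; here: the (III′) literal over HOLD), token for token: each theorem = its parent's signature with
# `JsRowD1Pin hodd Nw ↦ JsB12CombShSym hodd Nw (symTablesAn1S2 3 Lc cLam) cLam cBq` PLUS HOLD's two pins `hpinΛ : cLam·Lc⁴ = 2`, `hpinB : cBq = −Lc¹²∕4`; body = the parent's body with the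
# supplier swapped for HOLD §1.  (J-54 §2, the «C3-SBP» table END, is in the sibling `CombTowerEndRowD1MeanTable` §1.)  NOT covered by the OWNER gan24-p1 g56's `CombTowerEndRowD1Sockets`
# (which carries road BF-x's scalar `…_of_meanRoad` only).
# (G-an2-4 formalisation swarm, leaf prover `b2b-balaban-gan24-formalise-leaf-01` gen 91, [LEAF01-G91-INTENT-2] (M2); NOT asked by an2 (W-4 l.64553) — zero-weight junctions over DISPLAYED sockets)

HONEST DEPENDENCY (page 1, mandatory): continuum YM on T⁴ ⇐ BetaPertH ∧ nine spine estimates (0/9 proved); BetaPertH ⇐ (D1) ∧ (D4) ∧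
CAP+tail; G-an2-4 gates asym, D1 and NE2/3/4.  HONEST FRAMING (cell contract, verbatim): «discharging `BetaPertH` makes Bałaban's UV
stability UNCONDITIONAL — a real constructive-QFT result; it is NOT the continuum limit and NOT the Clay problem.»  THIS MODULE DISCHARGES
NOTHING of row D1: [folklore] composition BY NAME; 0 `def`, 0 cited fact, 0 `def … : Prop`, 0 sorry; no existing file touched.

CONTENT (odd `Lc ≥ 2`, Wilson table `Nw ≥ 2`, the two pins; `Nw : ℕ` (table) and `N : ℝ` (slope of `D1Drift`) kept apart, as in the parent):
* §1 **`d1Drift_BFx_total_mean_shell_JsB12CombShSym_an1_of_prop12`** — `RoadEndBFxTotalMeanShell.d1Drift_BFx_total_mean_shell_of_prop12` at the (III′) literal with `hall ∕ hθ0 ∕ hθ1 ⟸` HOLD §1.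
* §2 **`d1Drift_BFx_total_mean_shell_JsB12CombShSym_an1_of_prop12S`** — the «ENDₛ» variant (`RoadEndBFxTotalMeanShellS.…_of_prop12S`, rescaled tie `hωs`, rest words `restKS`).
* §3 **`d1Drift_BFx_total_mean_sbp_JsB12CombShSym_an1_of_prop12S`** — the «ENDₛ» variant with the MEAN shell identity summed by parts (`RoadEndBFxTotalMeanSbpS.…_sbp_of_prop12S`; rows
  `h0 ∕ h1 ∕ d0 ∕ d1`, NO second-difference row).
DISPLAYED DEBT OF THE MEAN LANE, BY NAME (verbatim from the parents, all road D1's): B1_mean; (K) `hK` + `hω`∕`hωs` + `hlam`; the five table sockets; `hdiv`; `hrowgh`; the leg rows; `hRestTot`;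
(U); the printed `h12`∕`h126` — and NO row G-an2-4 binder.  READING: after HOLD, road BF-x's total-mean ENDs at the (III′) literal of record owe row G-an2-4 NOTHING; what they display
is row D1's own debt.  NEVER «G-an2-4 closed» as (CONV-C) (HOLD is a statement about THIS chart of record — the U = 1 constituent at an1's sym tables); NOT D1, NOT `BetaPertH`, NOT
continuum, NOT Clay.  2026-08-28.
-/

noncomputable section

open Finset Filter Topology
open scoped BigOperators
open Literature.Probability.LatticeModels (annulus)
open Literature.MathematicalPhysics.QuantumFieldTheory
open Literature.MathematicalPhysics.QuantumFieldTheory.Balaban1983to89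
open Literature.MathematicalPhysics.QuantumFieldTheory.Balaban1983to89.Beta
open RemainderConstAllScales (AllScalesSeq)
open OneStepResolventKernel (JetData)
open OneStepKernelFamily (TbalOf D1Drift)
open WindowIdentification (fullSum)
open DyadicShell (Pt supNorm)
open ExpKernelCalculus (Site BiLoc shiftK)
open SquareTable (stK)
open GhostTable (gFree)
open BubbleTransfer (unitVec)
open DressedMomentNormalisation (resSite)
open AveragingContoursRooted (ctrOff)
open Summit.QuantumFields.BalabanUV.Beta.CombChartJointEnd (JsB12CombShSym)
open Summit.QuantumFields.BalabanUV.Beta.SymSecondOrderTablesAn1 (symTablesAn1S2)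
open Summit.QuantumFields.BalabanUV.Beta.GAN24.CombChargeRowsHold (exists_allScalesSeq_JsB12CombShSym_an1)
open Summit.QuantumFields.BalabanUV.Beta.D1BFx.ReducedKernel (TableR TOfRed)
open Summit.QuantumFields.BalabanUV.Beta.D1BFx.DressedTadpoleTable (tableRed)
open Summit.QuantumFields.BalabanUV.Beta.D1BFx.ReducedKernelSandwich (fineHess)
open Summit.QuantumFields.BalabanUV.Beta.D1BFx.FineStencilBFBalaban (SbfBal)
open Summit.QuantumFields.BalabanUV.Beta.D1BFx.SecondStencilBF (Wbf)
open Summit.QuantumFields.BalabanUV.Beta.D1BFx.GhostKernelComplete (PghQ fineHessGhQ)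
open Summit.QuantumFields.BalabanUV.Beta.D1BFx.FrozenLegProfile (gfrz)
open Summit.QuantumFields.BalabanUV.Beta.D1BFx.SplitInstance (RestIdx)
open Summit.QuantumFields.BalabanUV.Beta.D1BFx.SplitInstanceS (restKS)
open Summit.QuantumFields.BalabanUV.Beta.D1BFx.SplitRecut (restK')
open Summit.QuantumFields.BalabanUV.Beta.D1BFx.RoadEndBFxRecut (cornerIdx)
open Summit.QuantumFields.BalabanUV.Beta.D1BFx.FrozenLegTails (nOf MOf hn1)
open Summit.QuantumFields.BalabanUV.Beta.D1BFx.RoadEndBFxTotalMeanShell (d1Drift_BFx_total_mean_shell_of_prop12)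
open Summit.QuantumFields.BalabanUV.Beta.D1BFx.RoadEndBFxTotalMeanShellS (d1Drift_BFx_total_mean_shell_of_prop12S)
open Summit.QuantumFields.BalabanUV.Beta.D1BFx.RoadEndBFxTotalMeanSbpS (d1Drift_BFx_total_mean_sbp_of_prop12S)
open VectorTailsLoc (fam kfam)

namespace Summit.QuantumFields.BalabanUV.Beta.GAN24.CombTowerEndRowD1MeanShell

section MeanShell

variable {Lc : ℕ} [NeZero Lc] {a N : ℝ} {μ ν : Fin 4} {υ : Type*} [Fintype υ]
  {cE cVH cΛ cR cK cQ cE₂ cJ4 cΛ₂ cR₂ cQ₂ x₀ ωgl ωgh : ℕ → ℝ} {WE WJ WΛ WR WQ : ℕ → TableR} {CE CJ CΛ CRt CQ δW : ℕ → ℝ}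
  {Ru : υ → ℕ → ℝ} {CU : υ → ℝ} {CRtot : ℝ} {D₂ : ℝ}

/-- [folklore] **ROAD BF-x, MEAN GRADING, THE TOTAL-MEAN DEBT END AT THE (III′) LITERAL OF RECORD `JsB12CombShSym hodd Nw (symTablesAn1S2 3 Lc cLam) cLam cBq` — NO G-an2-4 ROW**
(odd `Lc ≥ 2`, `Nw ≥ 2`, pins `cLam·Lc⁴ = 2`, `cBq = −Lc¹²∕4`): `RoadEndBFxTotalMeanShell.d1Drift_BFx_total_mean_shell_of_prop12` at `Js :=` the (III′) literal with the all-scales bound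
`hall`∕`hθ0`∕`hθ1` SUPPLIED by HOLD §1 `CombChargeRowsHold.exists_allScalesSeq_JsB12CombShSym_an1` BY NAME (the (III′) twin of J-54 §1 `d1Drift_BFx_total_mean_shell_JsRowD1Pin_of_prop12`).
DISPLAYED DEBT OF THE MEAN LANE, BY NAME (verbatim from the parent, all road D1's): B1_mean; (K) `hK`+`hω`+`hlam`; the five table sockets; `hdiv`; `hrowgh`; shell rows `h2s`∕`d2s`;
`hRestTot`; (U); the printed `h12`∕`h126` — and NO row G-an2-4 binder.  `Nw : ℕ` (Wilson table) and `N : ℝ` (slope) kept apart. -/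
theorem d1Drift_BFx_total_mean_shell_JsB12CombShSym_an1_of_prop12 (hodd : Odd Lc) (hL : 2 ≤ Lc) {Nw : ℕ} (hNw : 2 ≤ Nw) {cLam cBq : ℝ}
    (hpinΛ : cLam * (Lc : ℝ) ^ 4 = 2) (hpinB : cBq = -((Lc : ℝ) ^ 12 / 4))
    -- the road's displayed debt, verbatim from `RoadEndBFxTotalMeanShell` §2
    (hμν : μ ≠ ν) (hN : N ≠ 0) (ha : 0 < a) (c : ℕ → ℝ) {A₂ δ₂ : ℝ} (hD₂ : 0 ≤ D₂) (hA₂ : 0 ≤ A₂) (hδ₂ : 0 < δ₂)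
    (h12 : B5.Prop12Printed (fam nOf hn1 MOf a ha)) (h126 : B5.Kernel126_127Printed (kfam nOf MOf))
    (h2s : ∀ n : ℕ, 2 ≤ n → ∀ [NeZero n], ∀ b ∈ (univ : Finset (Fin 4 → Fin n)).image resSite, ∀ r : ℕ, r + 1 ≤ n →
      ∑ v ∈ annulus 4 r (r + 1), |(gfrz n a b (v + unitVec ν + unitVec μ) - gFree (v + unitVec ν + unitVec μ)) -
          (gfrz n a b (v + unitVec ν) - gFree (v + unitVec ν)) - (gfrz n a b (v + unitVec μ) - gFree (v + unitVec μ)) +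
          (gfrz n a b v - gFree v)| ≤ D₂ / (n : ℝ))
    (d2s : ∀ n : ℕ, 2 ≤ n → ∀ [NeZero n], ∀ b ∈ (univ : Finset (Fin 4 → Fin n)).image resSite, ∀ r : ℕ, n ≤ r →
      ∑ v ∈ annulus 4 r (r + 1), |gfrz n a b (v + unitVec ν + unitVec μ) - gfrz n a b (v + unitVec ν) - gfrz n a b (v + unitVec μ) + gfrz n a b v| ≤
        A₂ * Real.exp (-(δ₂ / n) * ((r : ℝ) + 1)) / ((r : ℝ) + 1))
    -- bridge B1 in MEAN form for the literal of record
    (hB1 : Tendsto (fun m : ℕ => ((∑ j ∈ range m, B12Beta.secondMoment (TbalOf Lc (JsB12CombShSym hodd Nw (symTablesAn1S2 3 Lc cLam) cLam cBq) j) μ ν) - c (Lc ^ m)) / (m : ℝ))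
      atTop (𝓝 0))
    (hK : ∀ n : ℕ, 2 ≤ n → Odd n → ∀ [NeZero n], c n =
      ωgl n * B12Beta.secondMoment (TOfRed n a (SbfBal n a (cE n) (cVH n) (cΛ n) (cR n) (cK n) (cQ n))
        (tableRed n (Wbf (cE₂ n) (cJ4 n) (cΛ₂ n) (cR₂ n) (cQ₂ n) (WE n) (WJ n) (WΛ n) (WR n) (WQ n)))) μ ν
      + ωgh n * B12Beta.secondMoment (PghQ n a (x₀ n) (cK n) (cQ n)) μ ν + ∑ u, Ru u n)
    (hω : ∀ n : ℕ, 2 ≤ n → ωgh n * cK n ^ 2 = -2 * (ωgl n * cE n ^ 2)) (hlam : ∀ n : ℕ, 2 ≤ n → ωgl n * cE n ^ 2 = 2 * N ^ 2 * (n : ℝ) ^ 8)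
    (hδW : ∀ n, 0 < δW n)
    (hE : ∀ n κ u l u', BiLoc (WE n κ u l u') u u' (CE n) (δW n)) (hJ : ∀ n κ u l u', BiLoc (WJ n κ u l u') u u' (CJ n) (δW n))
    (hΛ : ∀ n κ u l u', BiLoc (WΛ n κ u l u') u u' (CΛ n) (δW n)) (hR : ∀ n κ u l u', BiLoc (WR n κ u l u') u u' (CRt n) (δW n))
    (hQ : ∀ n κ u l u', BiLoc (WQ n κ u l u') u u' (CQ n) (δW n))
    (hEc : ∀ (n : ℕ) (κ : Fin 4) (u : Site 4) (l : Fin 4) (u' t : Site 4),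
      WE n κ (u + (n : ℤ) • t) l (u' + (n : ℤ) • t) = shiftK (-((n : ℤ) • t)) (WE n κ u l u'))
    (hJc : ∀ (n : ℕ) (κ : Fin 4) (u : Site 4) (l : Fin 4) (u' t : Site 4),
      WJ n κ (u + (n : ℤ) • t) l (u' + (n : ℤ) • t) = shiftK (-((n : ℤ) • t)) (WJ n κ u l u'))
    (hΛc : ∀ (n : ℕ) (κ : Fin 4) (u : Site 4) (l : Fin 4) (u' t : Site 4),
      WΛ n κ (u + (n : ℤ) • t) l (u' + (n : ℤ) • t) = shiftK (-((n : ℤ) • t)) (WΛ n κ u l u'))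
    (hRc : ∀ (n : ℕ) (κ : Fin 4) (u : Site 4) (l : Fin 4) (u' t : Site 4),
      WR n κ (u + (n : ℤ) • t) l (u' + (n : ℤ) • t) = shiftK (-((n : ℤ) • t)) (WR n κ u l u'))
    (hQc : ∀ (n : ℕ) (κ : Fin 4) (u : Site 4) (l : Fin 4) (u' t : Site 4),
      WQ n κ (u + (n : ℤ) • t) l (u' + (n : ℤ) • t) = shiftK (-((n : ℤ) • t)) (WQ n κ u l u'))
    (hEs : ∀ n κ u l u', WE n κ u l u' = WE n l u' κ u) (hJs : ∀ n κ u l u', WJ n κ u l u' = WJ n l u' κ u)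
    (hΛs : ∀ n κ u l u', WΛ n κ u l u' = WΛ n l u' κ u) (hRs : ∀ n κ u l u', WR n κ u l u' = WR n l u' κ u)
    (hQs : ∀ n κ u l u', WQ n κ u l u' = WQ n l u' κ u)
    (hdiv : ∀ n : ℕ, 2 ≤ n → ∀ [NeZero n], ∀ (l' : Fin 4) (u' u : Site 4), ∑ κ' : Fin 4,
      (fineHess n a (SbfBal n a (cE n) (cVH n) (cΛ n) (cR n) (cK n) (cQ n))
          (Wbf (cE₂ n) (cJ4 n) (cΛ₂ n) (cR₂ n) (cQ₂ n) (WE n) (WJ n) (WΛ n) (WR n) (WQ n)) κ' l' (u - Pi.single κ' 1) u'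
        - fineHess n a (SbfBal n a (cE n) (cVH n) (cΛ n) (cR n) (cK n) (cQ n))
          (Wbf (cE₂ n) (cJ4 n) (cΛ₂ n) (cR₂ n) (cQ₂ n) (WE n) (WJ n) (WΛ n) (WR n) (WQ n)) κ' l' u u') = 0)
    (hrowgh : ∀ n : ℕ, 2 ≤ n → ∀ [NeZero n], ∀ (κ' l' : Fin 4) (b : Site 4), HasSum (fineHessGhQ n a (x₀ n) (cK n) (cQ n) κ' l' b) 0)
    (hRestTot : ∀ n : ℕ, 2 ≤ n → ∀ [NeZero n],
      |∑ b ∈ (univ : Finset (Fin 4 → Fin n)).image resSite, ((n : ℝ) ^ 4)⁻¹ *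
        fullSum (fun w : Pt => ∑ τ ∈ (univ : Finset RestIdx).erase cornerIdx,
          restK' n a (gfrz n a b) (cE n) (cΛ n) (cR n) (cK n) (cQ n) (cE₂ n) (cJ4 n) (cΛ₂ n) (cR₂ n) (cQ₂ n) (x₀ n)
            (WE n) (WJ n) (WΛ n) (WR n) (WQ n) (ωgl n) (ωgh n) ((n : ℝ) ^ 8) N μ ν b τ w)| ≤ CRtot)
    (hU : ∀ n : ℕ, 2 ≤ n → ∀ u, |Ru u n| ≤ CU u) :
    D1Drift Lc (JsB12CombShSym hodd Nw (symTablesAn1S2 3 Lc cLam) cLam cBq) N μ ν := by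
  obtain ⟨κ', θ', hθ0, hθ1, hall⟩ := exists_allScalesSeq_JsB12CombShSym_an1 hodd hL hNw hpinΛ hpinB μ ν
  exact d1Drift_BFx_total_mean_shell_of_prop12 (κ := κ') (θ := θ') _ hμν hN hL hodd ha c hD₂ hA₂ hδ₂ hall hθ0 hθ1 h12 h126 h2s d2s hB1 hK hω
    hlam hδW hE hJ hΛ hR hQ hEc hJc hΛc hRc hQc hEs hJs hΛs hRs hQs hdiv hrowgh hRestTot hU

end MeanShell

/-! ## §2–§3 Road BF-x's MEAN-grading debt ENDs «ENDₛ» at the (III′) literal of record — no G-an2-4 row -/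

section MeanS

variable {Lc : ℕ} [NeZero Lc] {a N : ℝ} {μ ν : Fin 4} {υ : Type*} [Fintype υ]
  {cE cVH cΛ cR cK cQ cE₂ cJ4 cΛ₂ cR₂ cQ₂ x₀ ωgl ωgh : ℕ → ℝ} {WE WJ WΛ WR WQ : ℕ → TableR} {CE CJ CΛ CRt CQ δW : ℕ → ℝ}
  {Ru : υ → ℕ → ℝ} {CU : υ → ℝ} {CRtot : ℝ} {D₂ : ℝ}

/-- [folklore] **«ENDₛ» VARIANT AT THE (III′) LITERAL OF RECORD** — `RoadEndBFxTotalMeanShellS.d1Drift_BFx_total_mean_shell_of_prop12S` at the (III′) literal (odd `Lc ≥ 2`, `Nw ≥ 2`,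
the two pins): road BF-x's MEAN-grading debt END with the rescaled tie `hωs` (displayed family `s`) and rest words `restKS (gfrz n a b) (s n • gfrz n a b)`; the all-scales bound SUPPLIED by
HOLD §1 (BY NAME) — the (III′) twin of J-54 §3.  DISPLAYED DEBT OF THE MEAN LANE, BY NAME (verbatim, all road D1's): B1_mean; (K) `hK`+`hωs`+`hlam`; the five table sockets; `hdiv`; `hrowgh`;
shell rows `h2s`∕`d2s`; `hRestTot`; (U); the printed `h12`∕`h126` — NO row G-an2-4 binder. -/
theorem d1Drift_BFx_total_mean_shell_JsB12CombShSym_an1_of_prop12S (hodd : Odd Lc) (hL : 2 ≤ Lc) {Nw : ℕ} (hNw : 2 ≤ Nw) {cLam cBq : ℝ}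
    (hpinΛ : cLam * (Lc : ℝ) ^ 4 = 2) (hpinB : cBq = -((Lc : ℝ) ^ 12 / 4))
    -- the road's displayed debt, verbatim from `RoadEndBFxTotalMeanShellS` §2
    (hμν : μ ≠ ν) (hN : N ≠ 0) (ha : 0 < a) (c : ℕ → ℝ) {A₂ δ₂ : ℝ} (hD₂ : 0 ≤ D₂) (hA₂ : 0 ≤ A₂) (hδ₂ : 0 < δ₂)
    (h12 : B5.Prop12Printed (fam nOf hn1 MOf a ha)) (h126 : B5.Kernel126_127Printed (kfam nOf MOf))
    (h2s : ∀ n : ℕ, 2 ≤ n → ∀ [NeZero n], ∀ b ∈ (univ : Finset (Fin 4 → Fin n)).image resSite, ∀ r : ℕ, r + 1 ≤ n →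
      ∑ v ∈ annulus 4 r (r + 1), |(gfrz n a b (v + unitVec ν + unitVec μ) - gFree (v + unitVec ν + unitVec μ)) -
          (gfrz n a b (v + unitVec ν) - gFree (v + unitVec ν)) - (gfrz n a b (v + unitVec μ) - gFree (v + unitVec μ)) +
          (gfrz n a b v - gFree v)| ≤ D₂ / (n : ℝ))
    (d2s : ∀ n : ℕ, 2 ≤ n → ∀ [NeZero n], ∀ b ∈ (univ : Finset (Fin 4 → Fin n)).image resSite, ∀ r : ℕ, n ≤ r →
      ∑ v ∈ annulus 4 r (r + 1), |gfrz n a b (v + unitVec ν + unitVec μ) - gfrz n a b (v + unitVec ν) - gfrz n a b (v + unitVec μ) + gfrz n a b v| ≤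
        A₂ * Real.exp (-(δ₂ / n) * ((r : ℝ) + 1)) / ((r : ℝ) + 1))
    -- bridge B1 in MEAN form for the literal of record
    (hB1 : Tendsto (fun m : ℕ => ((∑ j ∈ range m, B12Beta.secondMoment (TbalOf Lc (JsB12CombShSym hodd Nw (symTablesAn1S2 3 Lc cLam) cLam cBq) j) μ ν) - c (Lc ^ m)) / (m : ℝ))
      atTop (𝓝 0))
    (hK : ∀ n : ℕ, 2 ≤ n → Odd n → ∀ [NeZero n], c n =
      ωgl n * B12Beta.secondMoment (TOfRed n a (SbfBal n a (cE n) (cVH n) (cΛ n) (cR n) (cK n) (cQ n))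
        (tableRed n (Wbf (cE₂ n) (cJ4 n) (cΛ₂ n) (cR₂ n) (cQ₂ n) (WE n) (WJ n) (WΛ n) (WR n) (WQ n)))) μ ν
      + ωgh n * B12Beta.secondMoment (PghQ n a (x₀ n) (cK n) (cQ n)) μ ν + ∑ u, Ru u n)
    (s : ℕ → ℝ) (hωs : ∀ n : ℕ, 2 ≤ n → ωgh n * (s n * cK n) ^ 2 = -2 * (ωgl n * cE n ^ 2))
    (hlam : ∀ n : ℕ, 2 ≤ n → ωgl n * cE n ^ 2 = 2 * N ^ 2 * (n : ℝ) ^ 8)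
    (hδW : ∀ n, 0 < δW n)
    (hE : ∀ n κ u l u', BiLoc (WE n κ u l u') u u' (CE n) (δW n)) (hJ : ∀ n κ u l u', BiLoc (WJ n κ u l u') u u' (CJ n) (δW n))
    (hΛ : ∀ n κ u l u', BiLoc (WΛ n κ u l u') u u' (CΛ n) (δW n)) (hR : ∀ n κ u l u', BiLoc (WR n κ u l u') u u' (CRt n) (δW n))
    (hQ : ∀ n κ u l u', BiLoc (WQ n κ u l u') u u' (CQ n) (δW n))
    (hEc : ∀ (n : ℕ) (κ : Fin 4) (u : Site 4) (l : Fin 4) (u' t : Site 4),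
      WE n κ (u + (n : ℤ) • t) l (u' + (n : ℤ) • t) = shiftK (-((n : ℤ) • t)) (WE n κ u l u'))
    (hJc : ∀ (n : ℕ) (κ : Fin 4) (u : Site 4) (l : Fin 4) (u' t : Site 4),
      WJ n κ (u + (n : ℤ) • t) l (u' + (n : ℤ) • t) = shiftK (-((n : ℤ) • t)) (WJ n κ u l u'))
    (hΛc : ∀ (n : ℕ) (κ : Fin 4) (u : Site 4) (l : Fin 4) (u' t : Site 4),
      WΛ n κ (u + (n : ℤ) • t) l (u' + (n : ℤ) • t) = shiftK (-((n : ℤ) • t)) (WΛ n κ u l u'))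
    (hRc : ∀ (n : ℕ) (κ : Fin 4) (u : Site 4) (l : Fin 4) (u' t : Site 4),
      WR n κ (u + (n : ℤ) • t) l (u' + (n : ℤ) • t) = shiftK (-((n : ℤ) • t)) (WR n κ u l u'))
    (hQc : ∀ (n : ℕ) (κ : Fin 4) (u : Site 4) (l : Fin 4) (u' t : Site 4),
      WQ n κ (u + (n : ℤ) • t) l (u' + (n : ℤ) • t) = shiftK (-((n : ℤ) • t)) (WQ n κ u l u'))
    (hEs : ∀ n κ u l u', WE n κ u l u' = WE n l u' κ u) (hJs : ∀ n κ u l u', WJ n κ u l u' = WJ n l u' κ u)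
    (hΛs : ∀ n κ u l u', WΛ n κ u l u' = WΛ n l u' κ u) (hRs : ∀ n κ u l u', WR n κ u l u' = WR n l u' κ u)
    (hQs : ∀ n κ u l u', WQ n κ u l u' = WQ n l u' κ u)
    (hdiv : ∀ n : ℕ, 2 ≤ n → ∀ [NeZero n], ∀ (l' : Fin 4) (u' u : Site 4), ∑ κ' : Fin 4,
      (fineHess n a (SbfBal n a (cE n) (cVH n) (cΛ n) (cR n) (cK n) (cQ n))
          (Wbf (cE₂ n) (cJ4 n) (cΛ₂ n) (cR₂ n) (cQ₂ n) (WE n) (WJ n) (WΛ n) (WR n) (WQ n)) κ' l' (u - Pi.single κ' 1) u'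
        - fineHess n a (SbfBal n a (cE n) (cVH n) (cΛ n) (cR n) (cK n) (cQ n))
          (Wbf (cE₂ n) (cJ4 n) (cΛ₂ n) (cR₂ n) (cQ₂ n) (WE n) (WJ n) (WΛ n) (WR n) (WQ n)) κ' l' u u') = 0)
    (hrowgh : ∀ n : ℕ, 2 ≤ n → ∀ [NeZero n], ∀ (κ' l' : Fin 4) (b : Site 4), HasSum (fineHessGhQ n a (x₀ n) (cK n) (cQ n) κ' l' b) 0)
    (hRestTot : ∀ n : ℕ, 2 ≤ n → ∀ [NeZero n],
      |∑ b ∈ (univ : Finset (Fin 4 → Fin n)).image resSite, ((n : ℝ) ^ 4)⁻¹ *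
        fullSum (fun w : Pt => ∑ τ ∈ (univ : Finset RestIdx).erase cornerIdx,
          restKS n a (gfrz n a b) (fun v => s n * gfrz n a b v) (cE n) (cΛ n) (cR n) (cK n) (cQ n) (cE₂ n) (cJ4 n) (cΛ₂ n) (cR₂ n) (cQ₂ n) (x₀ n)
            (WE n) (WJ n) (WΛ n) (WR n) (WQ n) (ωgl n) (ωgh n) ((n : ℝ) ^ 8) N μ ν b τ w)| ≤ CRtot)
    (hU : ∀ n : ℕ, 2 ≤ n → ∀ u, |Ru u n| ≤ CU u) :
    D1Drift Lc (JsB12CombShSym hodd Nw (symTablesAn1S2 3 Lc cLam) cLam cBq) N μ ν := by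
  obtain ⟨κ', θ', hθ0, hθ1, hall⟩ := exists_allScalesSeq_JsB12CombShSym_an1 hodd hL hNw hpinΛ hpinB μ ν
  exact d1Drift_BFx_total_mean_shell_of_prop12S (κ := κ') (θ := θ') _ hμν hN hL hodd ha c hD₂ hA₂ hδ₂ hall hθ0 hθ1 h12 h126 h2s d2s hB1 hK s hωs
    hlam hδW hE hJ hΛ hR hQ hEc hJc hΛc hRc hQc hEs hJs hΛs hRs hQs hdiv hrowgh hRestTot hU

/-- [folklore] **«ENDₛ» VARIANT WITH NO SECOND-DIFFERENCE ROW AT THE (III′) LITERAL OF RECORD** — `RoadEndBFxTotalMeanSbpS.d1Drift_BFx_total_mean_sbp_of_prop12S` at the (III′)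
literal (odd `Lc ≥ 2`, `Nw ≥ 2`, the two pins): as §2 with `hD₂ hA₂ hδ₂ h2s d2s` deleted by the owner's «C3-SBP» summation-by-parts wall; the all-scales bound SUPPLIED by HOLD §1 (BY NAME) —
the (III′) twin of J-54 §4.  DISPLAYED DEBT OF THE MEAN LANE, BY NAME: B1_mean; (K) `hK`+`hωs`+`hlam`; the sockets; `hdiv`; `hrowgh`; `hRestTot`; (U); the printed `h12`∕`h126` — NO leg row and
NO row G-an2-4 binder. -/
theorem d1Drift_BFx_total_mean_sbp_JsB12CombShSym_an1_of_prop12S (hodd : Odd Lc) (hL : 2 ≤ Lc) {Nw : ℕ} (hNw : 2 ≤ Nw) {cLam cBq : ℝ}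
    (hpinΛ : cLam * (Lc : ℝ) ^ 4 = 2) (hpinB : cBq = -((Lc : ℝ) ^ 12 / 4))
    -- the road's displayed debt, verbatim from `RoadEndBFxTotalMeanSbpS` §2
    (hμν : μ ≠ ν) (hN : N ≠ 0) (ha : 0 < a) (c : ℕ → ℝ)
    (h12 : B5.Prop12Printed (fam nOf hn1 MOf a ha)) (h126 : B5.Kernel126_127Printed (kfam nOf MOf))
    -- bridge B1 in MEAN form for the literal of record
    (hB1 : Tendsto (fun m : ℕ => ((∑ j ∈ range m, B12Beta.secondMoment (TbalOf Lc (JsB12CombShSym hodd Nw (symTablesAn1S2 3 Lc cLam) cLam cBq) j) μ ν) - c (Lc ^ m)) / (m : ℝ))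
      atTop (𝓝 0))
    (hK : ∀ n : ℕ, 2 ≤ n → Odd n → ∀ [NeZero n], c n =
      ωgl n * B12Beta.secondMoment (TOfRed n a (SbfBal n a (cE n) (cVH n) (cΛ n) (cR n) (cK n) (cQ n))
        (tableRed n (Wbf (cE₂ n) (cJ4 n) (cΛ₂ n) (cR₂ n) (cQ₂ n) (WE n) (WJ n) (WΛ n) (WR n) (WQ n)))) μ ν
      + ωgh n * B12Beta.secondMoment (PghQ n a (x₀ n) (cK n) (cQ n)) μ ν + ∑ u, Ru u n)
    (s : ℕ → ℝ) (hωs : ∀ n : ℕ, 2 ≤ n → ωgh n * (s n * cK n) ^ 2 = -2 * (ωgl n * cE n ^ 2))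
    (hlam : ∀ n : ℕ, 2 ≤ n → ωgl n * cE n ^ 2 = 2 * N ^ 2 * (n : ℝ) ^ 8)
    (hδW : ∀ n, 0 < δW n)
    (hE : ∀ n κ u l u', BiLoc (WE n κ u l u') u u' (CE n) (δW n)) (hJ : ∀ n κ u l u', BiLoc (WJ n κ u l u') u u' (CJ n) (δW n))
    (hΛ : ∀ n κ u l u', BiLoc (WΛ n κ u l u') u u' (CΛ n) (δW n)) (hR : ∀ n κ u l u', BiLoc (WR n κ u l u') u u' (CRt n) (δW n))
    (hQ : ∀ n κ u l u', BiLoc (WQ n κ u l u') u u' (CQ n) (δW n))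
    (hEc : ∀ (n : ℕ) (κ : Fin 4) (u : Site 4) (l : Fin 4) (u' t : Site 4),
      WE n κ (u + (n : ℤ) • t) l (u' + (n : ℤ) • t) = shiftK (-((n : ℤ) • t)) (WE n κ u l u'))
    (hJc : ∀ (n : ℕ) (κ : Fin 4) (u : Site 4) (l : Fin 4) (u' t : Site 4),
      WJ n κ (u + (n : ℤ) • t) l (u' + (n : ℤ) • t) = shiftK (-((n : ℤ) • t)) (WJ n κ u l u'))
    (hΛc : ∀ (n : ℕ) (κ : Fin 4) (u : Site 4) (l : Fin 4) (u' t : Site 4),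
      WΛ n κ (u + (n : ℤ) • t) l (u' + (n : ℤ) • t) = shiftK (-((n : ℤ) • t)) (WΛ n κ u l u'))
    (hRc : ∀ (n : ℕ) (κ : Fin 4) (u : Site 4) (l : Fin 4) (u' t : Site 4),
      WR n κ (u + (n : ℤ) • t) l (u' + (n : ℤ) • t) = shiftK (-((n : ℤ) • t)) (WR n κ u l u'))
    (hQc : ∀ (n : ℕ) (κ : Fin 4) (u : Site 4) (l : Fin 4) (u' t : Site 4),
      WQ n κ (u + (n : ℤ) • t) l (u' + (n : ℤ) • t) = shiftK (-((n : ℤ) • t)) (WQ n κ u l u'))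
    (hEs : ∀ n κ u l u', WE n κ u l u' = WE n l u' κ u) (hJs : ∀ n κ u l u', WJ n κ u l u' = WJ n l u' κ u)
    (hΛs : ∀ n κ u l u', WΛ n κ u l u' = WΛ n l u' κ u) (hRs : ∀ n κ u l u', WR n κ u l u' = WR n l u' κ u)
    (hQs : ∀ n κ u l u', WQ n κ u l u' = WQ n l u' κ u)
    (hdiv : ∀ n : ℕ, 2 ≤ n → ∀ [NeZero n], ∀ (l' : Fin 4) (u' u : Site 4), ∑ κ' : Fin 4,
      (fineHess n a (SbfBal n a (cE n) (cVH n) (cΛ n) (cR n) (cK n) (cQ n))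
          (Wbf (cE₂ n) (cJ4 n) (cΛ₂ n) (cR₂ n) (cQ₂ n) (WE n) (WJ n) (WΛ n) (WR n) (WQ n)) κ' l' (u - Pi.single κ' 1) u'
        - fineHess n a (SbfBal n a (cE n) (cVH n) (cΛ n) (cR n) (cK n) (cQ n))
          (Wbf (cE₂ n) (cJ4 n) (cΛ₂ n) (cR₂ n) (cQ₂ n) (WE n) (WJ n) (WΛ n) (WR n) (WQ n)) κ' l' u u') = 0)
    (hrowgh : ∀ n : ℕ, 2 ≤ n → ∀ [NeZero n], ∀ (κ' l' : Fin 4) (b : Site 4), HasSum (fineHessGhQ n a (x₀ n) (cK n) (cQ n) κ' l' b) 0)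
    (hRestTot : ∀ n : ℕ, 2 ≤ n → ∀ [NeZero n],
      |∑ b ∈ (univ : Finset (Fin 4 → Fin n)).image resSite, ((n : ℝ) ^ 4)⁻¹ *
        fullSum (fun w : Pt => ∑ τ ∈ (univ : Finset RestIdx).erase cornerIdx,
          restKS n a (gfrz n a b) (fun v => s n * gfrz n a b v) (cE n) (cΛ n) (cR n) (cK n) (cQ n) (cE₂ n) (cJ4 n) (cΛ₂ n) (cR₂ n) (cQ₂ n) (x₀ n)
            (WE n) (WJ n) (WΛ n) (WR n) (WQ n) (ωgl n) (ωgh n) ((n : ℝ) ^ 8) N μ ν b τ w)| ≤ CRtot)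
    (hU : ∀ n : ℕ, 2 ≤ n → ∀ u, |Ru u n| ≤ CU u) :
    D1Drift Lc (JsB12CombShSym hodd Nw (symTablesAn1S2 3 Lc cLam) cLam cBq) N μ ν := by
  obtain ⟨κ', θ', hθ0, hθ1, hall⟩ := exists_allScalesSeq_JsB12CombShSym_an1 hodd hL hNw hpinΛ hpinB μ ν
  exact d1Drift_BFx_total_mean_sbp_of_prop12S (κ := κ') (θ := θ') _ hμν hN hL hodd ha c hall hθ0 hθ1 h12 h126 hB1 hK s hωs
    hlam hδW hE hJ hΛ hR hQ hEc hJc hΛc hRc hQc hEs hJs hΛs hRs hQs hdiv hrowgh hRestTot hU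

end MeanS

end Summit.QuantumFields.BalabanUV.Beta.GAN24.CombTowerEndRowD1MeanShell

end
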